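import Literature.Analysis.Complex.PolyaWimanOrderLtTwo
import Literature.Analysis.Complex.JensenPolynomialHyperbolicity
import Mathlib.Analysis.Complex.TaylorSeries
import HarnessLib

/-!
# Jensen polynomials and the Laguerre–Pólya class (Pólya–Schur / Jensen), proved

Topic `Literature/Analysis/Complex` (trunk T-CA); theorem-only companion of `LaguerrePolyaClass.lean`
(definition `IsLaguerrePolya`) and `PolyaWimanOrderLtTwo.lean`. Everything here is PROVED; no
definitions, no named facts.

For a real entire function `φ(z) = ∑ γ_k z^k / k!` (`γ_k = φ^{(k)}(0) ∈ ℝ`) the **Jensen polynomials**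
are `J^{d,n}_γ(X) = ∑_{j ≤ d} (d choose j) γ_{n+j} X^j` (the tree's
`Literature.NumberTheory.LFunctions.jensenPoly γ d n`; `γ = taylorCoeffSeq φ` and
`J^{d,n} = classicalJensenPoly φ d n` in `Literature/Barriers/RiemannHypothesis/JensenPolynomials.lean`).
The classical theorem of Jensen (1913) and Pólya–Schur (1914) — Craven–Csordas 1989, §1 (i):
"for a function `φ(x) = Σ γ_k x^k/k!` in the Laguerre–Pólya class … the Jensen polynomials
`g_n(x) = Σ (n choose k) γ_k x^k` have only real zeros", with the converse by their Lemma 2.2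
(`g_n(x/n) → φ(x)` locally uniformly); Craven–Csordas 2006, Thm. 3.3 ("algebraic
characterization") — becomes, with Kim's limit definition of `𝓛𝓟` used in the tree:

* `Literature.Analysis.Complex.isLaguerrePolya_iff_forall_splits_jensenPoly` — for `φ` entire and
  real on `ℝ`: **`φ ∈ 𝓛𝓟 ↔` every `J^{d,n}_γ` is hyperbolic** (`↔ AllHyperbolic (taylorCoeffSeq φ)`,
  `isLaguerrePolya_iff_allHyperbolic`); the direction `←` uses only the shifts `n = 0`
  (`isLaguerrePolya_of_forall_splits_jensenPoly`).
* `Literature.Analysis.Complex.isLaguerrePolya_iteratedDeriv_iff` — the shifted form: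
  **`φ^{(n)} ∈ 𝓛𝓟 ↔ ∀ d, J^{d,n}_γ` hyperbolic** (row `n` of the Jensen table; statement (i) of
  LINE L4 «Jensen edge law», `stmt-RiemannHypothesis-22178`).
* `Literature.Analysis.Complex.polyaWiman_splits_jensenPoly` — with the Pólya–Wiman theorem of
  `PolyaWimanOrderLtTwo.lean`: for `F` real entire of order `< 2` with finitely many non-real
  zeros, **`∃ N, ∀ n ≥ N, ∀ d, J^{d,n}` is hyperbolic** — uniform in the degree `d`, the global
  form of which Kim's corollary `Farmer2022_kimCorollary` (`∀ d, ∃ N`) is the shadow.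

Proofs. `→`: the approximants `P_m → φ` of the definition converge with all derivatives
(Weierstrass), so `J^{d,n}` of `P_m` — real-rooted by the polynomial case
`PolyaSchur.splits_jensenPoly_taylorSeq` (Hermite–Poulain) — converge coefficientwise to `J^{d,n}_γ`,
and real-rootedness in bounded degree is closed (`PolyaSchur.splits_of_tendsto_coeff`, Hurwitz).
`←`: `J^{d,0}_γ(z/d)` are real-rooted real polynomials converging to `φ` locally uniformly
(`PolyaSchur.tendstoLocallyUniformly_jensenPoly_scaled`, Craven–Csordas Lemma 2.2, fed with the
Taylor expansion of an entire function, `Complex.hasSum_taylorSeries_of_entire`, and Cauchy's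
estimate for its absolute convergence) — which is membership in `𝓛𝓟` by definition.

## References

* T. Craven, G. Csordas, *Jensen polynomials and the Turán and Laguerre inequalities*, Pacific J.
  Math. 136 (1989) 241–260, §1 (i), Lemma 2.2 [CravenCsordas1989].
* T. Craven, G. Csordas, *Composition theorems, multiplier sequences and complex zero decreasing
  sequences* (2006), Thm. 3.3, Remark 3.2 [CravenCsordas2006].
* G. Pólya, J. Schur, *Über zwei Arten von Faktorenfolgen in der Theorie der algebraischen
  Gleichungen*, J. reine angew. Math. 144 (1914) 89–113.
* H. Ki, Y.-O. Kim, Duke Math. J. 104 (2000), §2 Thm. 2.1 [KiKim2000] (Pólya–Wiman).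
-/

noncomputable section

open Complex Filter Metric Set Topology Polynomial

namespace Literature.Analysis.Complex

open Literature.NumberTheory.LFunctions (jensenPoly)
open Literature.Analysis.Complex.PolyaSchur (taylorSeq coeff_jensenPoly splits_jensenPoly_taylorSeq
  splits_of_tendsto_coeff tendstoLocallyUniformly_jensenPoly_scaled)
open Literature.Analysis.TotalPositivity (iteratedDeriv_polynomial_eval_zero)
open Literature.Barriers.RiemannHypothesis (taylorCoeffSeq classicalJensenPoly AllHyperbolic)

section Jensen

variable {φ : ℂ → ℂ}

/-! ## Taylor data of a real entire function -/

/-- For `φ` entire and real on `ℝ`, `φ^{(k)}(0)` is real. [folklore] -/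
private theorem ofReal_re_iteratedDeriv (hφd : Differentiable ℂ φ) (hreal : IsRealOnReal φ)
    (k : ℕ) : (((iteratedDeriv k φ 0).re : ℝ) : ℂ) = iteratedDeriv k φ 0 := by
  apply Complex.ext
  · simp
  · have h := im_iteratedDeriv_ofReal hφd hreal k 0
    simp only [Complex.ofReal_zero] at h
    simp [h]

/-- The Taylor expansion of a real entire function at `0`, in the format `∑ γ_j w^j / j!` of
`PolyaSchur.tendstoLocallyUniformly_jensenPoly_scaled`. [folklore] -/
private theorem hasSum_taylor (hφd : Differentiable ℂ φ) (hreal : IsRealOnReal φ) (w : ℂ) :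
    HasSum (fun j ↦ (((iteratedDeriv j φ 0).re : ℝ) : ℂ) / (j.factorial : ℂ) * w ^ j) (φ w) := by
  have h := Complex.hasSum_taylorSeries_of_entire hφd 0 w
  refine h.congr_fun fun j ↦ ?_
  rw [ofReal_re_iteratedDeriv hφd hreal, sub_zero, smul_eq_mul, smul_eq_mul]
  ring

/-- Absolute convergence of the Taylor series of an entire function on every disc (Cauchy's
estimate on the circle of radius `2R + 1`). [folklore] -/
private theorem summable_abs_taylor (hφd : Differentiable ℂ φ) (R : ℝ) (hR : 0 ≤ R) :
    Summable fun j ↦ |(iteratedDeriv j φ 0).re| / (j.factorial : ℝ) * R ^ j := by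
  set S : ℝ := 2 * R + 1 with hS
  have hS0 : 0 < S := by positivity
  obtain ⟨M, hM⟩ := (isCompact_sphere (0 : ℂ) S).exists_bound_of_continuousOn
    hφd.continuous.continuousOn
  have hSmem : ((S : ℝ) : ℂ) ∈ sphere (0 : ℂ) S := by
    rw [mem_sphere_zero_iff_norm, Complex.norm_real, Real.norm_of_nonneg hS0.le]
  have hM0 : 0 ≤ M := (norm_nonneg _).trans (hM _ hSmem)
  have hq : R / S < 1 := by rw [div_lt_one hS0]; linarith
  have hq0 : 0 ≤ R / S := by positivity
  refine Summable.of_nonneg_of_le (fun j ↦ by positivity) (fun j ↦ ?_)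
    ((summable_geometric_of_lt_one hq0 hq).mul_left M)
  have hc : ‖iteratedDeriv j φ 0‖ ≤ j.factorial * M / S ^ j :=
    Complex.norm_iteratedDeriv_le_of_forall_mem_sphere_norm_le j hS0 hφd.diffContOnCl hM
  have h1 : |(iteratedDeriv j φ 0).re| ≤ j.factorial * M / S ^ j := (Complex.abs_re_le_norm _).trans hc
  have hj : (0 : ℝ) < j.factorial := by positivity
  calc |(iteratedDeriv j φ 0).re| / (j.factorial : ℝ) * R ^ j ≤ (j.factorial * M / S ^ j) / j.factorial * R ^ j := by
        gcongr
    _ = M * (R / S) ^ j := by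
        rw [div_pow]
        field_simp

/-! ## The approximants converge with all derivatives -/

/-- Locally uniform convergence of polynomials to `φ` passes to the `k`-th derivatives at `0`
(Weierstrass). [folklore] -/
private theorem tendsto_iteratedDeriv_at_zero {P : ℕ → ℝ[X]}
    (hlim : TendstoLocallyUniformly (fun n z ↦ ((P n).map (algebraMap ℝ ℂ)).eval z) φ atTop)
    (k : ℕ) :
    Tendsto (fun n ↦ iteratedDeriv k (fun z ↦ ((P n).map (algebraMap ℝ ℂ)).eval z) 0) atTop
      (𝓝 (iteratedDeriv k φ 0)) := by
  have hF : ∀ n, Differentiable ℂ (fun z ↦ ((P n).map (algebraMap ℝ ℂ)).eval z) := fun n ↦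
    Polynomial.differentiable _
  have key : ∀ k, TendstoLocallyUniformlyOn
      (fun n ↦ iteratedDeriv k (fun z ↦ ((P n).map (algebraMap ℝ ℂ)).eval z))
      (iteratedDeriv k φ) atTop univ := by
    intro k
    induction k with
    | zero => simpa using tendstoLocallyUniformlyOn_univ.2 hlim
    | succ k ih =>
      have h := ih.deriv (Eventually.of_forall fun n ↦
        (differentiable_iteratedDeriv_of_entire (hF n) k).differentiableOn) isOpen_univ
      simpa only [iteratedDeriv_succ, Function.comp_def] using h
  exact (key k).tendsto_at (mem_univ 0)

/-- The Taylor data of a real polynomial viewed over `ℂ`: `(P.map ℂ)^{(k)}(0) = k! · P_k`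
(`= PolyaSchur.taylorSeq P k`). [folklore] -/
private theorem iteratedDeriv_eval_map_zero (P : ℝ[X]) (k : ℕ) :
    iteratedDeriv k (fun z ↦ (P.map (algebraMap ℝ ℂ)).eval z) 0 = ((taylorSeq P k : ℝ) : ℂ) := by
  rw [iteratedDeriv_polynomial_eval_zero, Polynomial.coeff_map, taylorSeq, Complex.ofReal_mul,
    Complex.ofReal_natCast]
  rfl

/-! ## `φ ∈ 𝓛𝓟 ⟹` all Jensen polynomials are hyperbolic -/

/-- **Jensen / Pólya–Schur: the Jensen polynomials of a function of the Laguerre–Pólya class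
are hyperbolic**, for every degree `d` and shift `n` (Craven–Csordas 1989, §1 (i)): `J^{d,n}` of
the real-rooted approximants `P_m` are real-rooted (Hermite–Poulain,
`PolyaSchur.splits_jensenPoly_taylorSeq`) and converge coefficientwise to `J^{d,n}_γ`, since
`P_m^{(k)}(0) → φ^{(k)}(0)` (Weierstrass); bounded-degree limits of real-rooted polynomials are
real-rooted (`PolyaSchur.splits_of_tendsto_coeff`).
[cite: CravenCsordas1989, §1 (i)] [cite: CravenCsordas2006, Thm. 3.3 and Remark 3.2 (a)] -/
theorem IsLaguerrePolya.splits_jensenPoly (hφ : IsLaguerrePolya φ) (d n : ℕ) :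
    (jensenPoly (fun k ↦ (_root_.iteratedDeriv k φ 0).re) d n).Splits := by
  obtain ⟨P, hP, hlim⟩ := hφ
  refine splits_of_tendsto_coeff (l := atTop) (P := fun m ↦ jensenPoly (taylorSeq (P m)) d n)
    (N := d) (fun m ↦ PolyaSchur.natDegree_jensenPoly_le _ d n)
    (PolyaSchur.natDegree_jensenPoly_le _ d n) (fun j ↦ ?_)
    (Eventually.of_forall fun m ↦ splits_jensenPoly_taylorSeq (hP m) d n)
  simp only [coeff_jensenPoly]
  split_ifs with hj
  · have h := (Complex.continuous_re.tendsto _).comp (tendsto_iteratedDeriv_at_zero hlim (n + j))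
    have h' : Tendsto (fun m ↦ taylorSeq (P m) (n + j)) atTop (𝓝 (_root_.iteratedDeriv (n + j) φ 0).re) := by
      convert h using 1
      funext m
      simp only [Function.comp_apply, iteratedDeriv_eval_map_zero, Complex.ofReal_re]
    exact tendsto_const_nhds.mul h'
  · exact tendsto_const_nhds

/-! ## `⟸`: hyperbolic Jensen polynomials put `φ` in `𝓛𝓟` -/

/-- **Converse (Craven–Csordas 1989, Lemma 2.2; Pólya–Schur):** if `φ` is entire, real on `ℝ`,
and every `J^{d,0}_γ` (`γ_k = φ^{(k)}(0)`) is hyperbolic, then `φ ∈ 𝓛𝓟` — indeed the real-rooted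
real polynomials `J^{d,0}_γ(z/d)` converge to `φ` locally uniformly, which is Kim's definition.
[cite: CravenCsordas1989, Lemma 2.2 and §1 (i)] [cite: CravenCsordas2006, Thm. 3.3] -/
theorem isLaguerrePolya_of_forall_splits_jensenPoly (hφd : Differentiable ℂ φ)
    (hreal : IsRealOnReal φ)
    (hs : ∀ d : ℕ, (jensenPoly (fun k ↦ (iteratedDeriv k φ 0).re) d 0).Splits) :
    IsLaguerrePolya φ := by
  set γ : ℕ → ℝ := fun k ↦ (iteratedDeriv k φ 0).re with hγ
  have hconv := tendstoLocallyUniformly_jensenPoly_scaled (γ := γ) (F := φ)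
    (summable_abs_taylor hφd) (hasSum_taylor hφd hreal)
  refine ⟨fun d ↦ (jensenPoly γ d 0).comp (C ((d : ℝ)⁻¹) * X),
    fun d ↦ (hs d).comp_of_natDegree_le_one ((natDegree_C_mul_le _ _).trans natDegree_X_le), ?_⟩
  convert hconv using 1
  funext d z
  rw [Polynomial.map_comp, Polynomial.eval_comp, Polynomial.eval_map_algebraMap,
    Polynomial.eval_map_algebraMap]
  congr 1
  simp [div_eq_inv_mul]

/-- **`φ ∈ 𝓛𝓟 ↔` all Jensen polynomials `J^{d,n}_γ` are hyperbolic** (`φ` entire, real on `ℝ`,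
`γ_k = φ^{(k)}(0)`): the Jensen–Pólya–Schur characterisation of the Laguerre–Pólya class
(Craven–Csordas 2006, Thm. 3.3, "algebraic characterization", for multiplier sequences; 1989 §1 (i)).
[cite: CravenCsordas1989, §1 (i) and Lemma 2.2] [cite: CravenCsordas2006, Thm. 3.3] -/
theorem isLaguerrePolya_iff_forall_splits_jensenPoly (hφd : Differentiable ℂ φ)
    (hreal : IsRealOnReal φ) :
    IsLaguerrePolya φ ↔ ∀ d n : ℕ, (jensenPoly (fun k ↦ (iteratedDeriv k φ 0).re) d n).Splits :=
  ⟨fun h d n ↦ h.splits_jensenPoly d n,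
    fun h ↦ isLaguerrePolya_of_forall_splits_jensenPoly hφd hreal fun d ↦ h d 0⟩

/-- The same in the vocabulary of `Literature/Barriers/RiemannHypothesis/JensenPolynomials.lean`:
`φ ∈ 𝓛𝓟 ↔ AllHyperbolic (taylorCoeffSeq φ)`. [cite: CravenCsordas1989, §1 (i) and Lemma 2.2] -/
theorem isLaguerrePolya_iff_allHyperbolic (hφd : Differentiable ℂ φ) (hreal : IsRealOnReal φ) :
    IsLaguerrePolya φ ↔ AllHyperbolic (taylorCoeffSeq φ) :=
  isLaguerrePolya_iff_forall_splits_jensenPoly hφd hreal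

/-! ## Rows of the Jensen table: `φ^{(n)} ∈ 𝓛𝓟 ↔ ∀ d, J^{d,n}` hyperbolic -/

/-- The shift rule `J^{d,n}_γ = J^{d,0}_{γ(n + ·)}` (same statement as
`Literature.Barriers.RiemannHypothesis.jensenPoly_shift`, in a file not imported here). [folklore] -/
private theorem jensenPoly_shift' (γ : ℕ → ℝ) (d n : ℕ) :
    jensenPoly γ d n = jensenPoly (fun k ↦ γ (n + k)) d 0 := by
  ext j
  simp only [coeff_jensenPoly, zero_add]

/-- `(φ^{(n)})^{(k)} = φ^{(n+k)}`. [folklore] -/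
private theorem iteratedDeriv_iteratedDeriv' (n k : ℕ) :
    iteratedDeriv k (iteratedDeriv n φ) = iteratedDeriv (n + k) φ := by
  rw [iteratedDeriv_eq_iterate, iteratedDeriv_eq_iterate, iteratedDeriv_eq_iterate, add_comm,
    Function.iterate_add_apply]

/-- **Row `n` of the Jensen table** (statement (i) of the Jensen edge law, entire form): for
`φ` entire and real on `ℝ`, `φ^{(n)} ∈ 𝓛𝓟` iff `J^{d,n}_γ` is hyperbolic for every degree `d`
(the Taylor data of `φ^{(n)}` is the shifted sequence `γ_{n+k}`).
[cite: CravenCsordas1989, §1 (i), Lemma 2.2, eq. (2.3)] -/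
theorem isLaguerrePolya_iteratedDeriv_iff (hφd : Differentiable ℂ φ) (hreal : IsRealOnReal φ)
    (n : ℕ) :
    IsLaguerrePolya (iteratedDeriv n φ) ↔
      ∀ d : ℕ, (jensenPoly (fun k ↦ (iteratedDeriv k φ 0).re) d n).Splits := by
  have hd : Differentiable ℂ (iteratedDeriv n φ) := differentiable_iteratedDeriv_of_entire hφd n
  have hr : IsRealOnReal (iteratedDeriv n φ) := fun x ↦ im_iteratedDeriv_ofReal hφd hreal n x
  have hkey : ∀ d m : ℕ, jensenPoly (fun k ↦ (iteratedDeriv k (iteratedDeriv n φ) 0).re) d m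
      = jensenPoly (fun k ↦ (iteratedDeriv k φ 0).re) d (n + m) := by
    intro d m
    rw [jensenPoly_shift', jensenPoly_shift' _ d (n + m)]
    congr 1
    funext k
    rw [iteratedDeriv_iteratedDeriv', add_assoc]
  constructor
  · intro h d
    have := h.splits_jensenPoly d 0
    rwa [hkey, add_zero] at this
  · intro h
    exact isLaguerrePolya_of_forall_splits_jensenPoly hd hr fun d ↦ by
      rw [hkey, add_zero]; exact h d

/-- Row form in Farmer's notation: `φ^{(n)} ∈ 𝓛𝓟 ↔ ∀ d, J^{d,n}_{φ,cl}` hyperbolic.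
[cite: CravenCsordas1989, §1 (i)] [cite: Farmer2022, §2 eq. (2.2)] -/
theorem isLaguerrePolya_iteratedDeriv_iff_classicalJensenPoly (hφd : Differentiable ℂ φ)
    (hreal : IsRealOnReal φ) (n : ℕ) :
    IsLaguerrePolya (iteratedDeriv n φ) ↔ ∀ d : ℕ, (classicalJensenPoly φ d n).Splits :=
  isLaguerrePolya_iteratedDeriv_iff hφd hreal n

/-! ## Pólya–Wiman in the Jensen table: all rows beyond `N` are entirely hyperbolic -/

/-- **Pólya–Wiman, Jensen-polynomial form, uniform in the degree**: for `F` real entire of order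
`< 2` with finitely many non-real zeros there is `N` with `J^{d,n}_γ` hyperbolic for all `n ≥ N` and
ALL `d` (combine `polyaWiman_of_isEntireOfOrderLt_two` with the row characterisation).
[cite: KiKim2000, §2 Thm. 2.1] [cite: CravenCsordas1989, §1 (i)] -/
theorem polyaWiman_splits_jensenPoly {F : ℂ → ℂ} (hF : IsEntireOfOrderLt 2 F)
    (hreal : IsRealOnReal F) (hfin : {z : ℂ | F z = 0 ∧ z.im ≠ 0}.Finite) :
    ∃ N : ℕ, ∀ n : ℕ, N ≤ n →
      ∀ d : ℕ, (jensenPoly (fun k ↦ (iteratedDeriv k F 0).re) d n).Splits := by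
  obtain ⟨N, hN⟩ := polyaWiman_of_isEntireOfOrderLt_two hF hreal hfin
  exact ⟨N, fun n hn d ↦ (isLaguerrePolya_iteratedDeriv_iff hF.1 hreal n).1 (hN n hn) d⟩

/-- The same in Farmer's notation `J^{d,n}_{F,cl}` — compare the degree-wise shadow
`Literature.Barriers.RiemannHypothesis.Farmer2022_kimCorollary` (`∀ d, ∃ N`).
[cite: KiKim2000, §2 Thm. 2.1] [cite: Farmer2022, §2] -/
theorem polyaWiman_splits_classicalJensenPoly {F : ℂ → ℂ} (hF : IsEntireOfOrderLt 2 F)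
    (hreal : IsRealOnReal F) (hfin : {z : ℂ | F z = 0 ∧ z.im ≠ 0}.Finite) :
    ∃ N : ℕ, ∀ n : ℕ, N ≤ n → ∀ d : ℕ, (classicalJensenPoly F d n).Splits :=
  polyaWiman_splits_jensenPoly hF hreal hfin

/-! ## The Hurwitz onset: a non-real zero of `φ` makes `J^{d,0}_γ` non-hyperbolic for all large `d`
(v2 append) -/

/-- A real entire function that is not identically zero has a nonzero Taylor coefficient at `0`.
[folklore] -/
private theorem exists_re_iteratedDeriv_ne_zero (hφd : Differentiable ℂ φ) (hreal : IsRealOnReal φ)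
    (h0 : ∃ w, φ w ≠ 0) : ∃ k : ℕ, (iteratedDeriv k φ 0).re ≠ 0 := by
  by_contra h
  push Not at h
  obtain ⟨w, hw⟩ := h0
  apply hw
  have hs := hasSum_taylor hφd hreal w
  have hzero : (fun j ↦ (((iteratedDeriv j φ 0).re : ℝ) : ℂ) / (j.factorial : ℂ) * w ^ j) = fun _ ↦ 0 := by
    funext j
    rw [h j, Complex.ofReal_zero, zero_div, zero_mul]
  rw [hzero] at hs
  exact hs.unique hasSum_zero ▸ rfl

/-- **Hurwitz onset.** If `φ` is entire, real on `ℝ`, not identically zero, and has a non-real zero,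
then the Jensen polynomials `J^{d,0}_γ` (`γ_k = φ^{(k)}(0)`) are NOT hyperbolic for all sufficiently
large `d`: the scaled polynomials `J^{d,0}_γ(w/d) → φ` locally uniformly (Craven–Csordas 1989,
Lemma 2.2), so by Hurwitz's theorem they eventually vanish near the non-real zero of `φ`.
[cite: CravenCsordas1989, Lemma 2.2] [cite: Conway1978, Ch. VII Thm. 2.5] -/
theorem eventually_not_splits_jensenPoly_of_nonreal_zero (hφd : Differentiable ℂ φ)
    (hreal : IsRealOnReal φ) (h0 : ∃ w, φ w ≠ 0) {c : ℂ} (hc : φ c = 0) (hci : c.im ≠ 0) :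
    ∃ d₀ : ℕ, ∀ d : ℕ, d₀ ≤ d → ¬ (jensenPoly (fun k ↦ (iteratedDeriv k φ 0).re) d 0).Splits := by
  set γ : ℕ → ℝ := fun k ↦ (iteratedDeriv k φ 0).re with hγ
  have hconv := tendstoLocallyUniformly_jensenPoly_scaled (γ := γ) (F := φ)
    (summable_abs_taylor hφd) (hasSum_taylor hφd hreal)
  -- `c` is an isolated zero: choose a circle about `c`, off the real axis, free of zeros of `φ`
  have han : AnalyticAt ℂ φ c := hφd.analyticAt c
  have hnot : ¬ (∀ᶠ z in 𝓝 c, φ z = 0) := by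
    intro hloc
    obtain ⟨w, hw⟩ := h0
    exact hw ((hφd.differentiableOn.analyticOnNhd isOpen_univ).eqOn_zero_of_preconnected_of_eventuallyEq_zero
      isPreconnected_univ (mem_univ c) hloc (mem_univ w))
  rcases han.eventually_eq_zero_or_eventually_ne_zero with h | h
  · exact absurd h hnot
  obtain ⟨ε, hε, hball⟩ := Metric.eventually_nhds_iff.1 (eventually_nhdsWithin_iff.1 h)
  set r : ℝ := min (ε / 2) (|c.im| / 2) with hr
  have hrpos : 0 < r := lt_min (by positivity) (by positivity)
  have hrε : r < ε := (min_le_left _ _).trans_lt (by linarith)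
  have hrim : r < |c.im| := (min_le_right _ _).trans_lt (by linarith [abs_pos.2 hci])
  have hsphere : ∀ z ∈ sphere c r, φ z ≠ 0 := by
    intro z hz
    have hzc : dist z c = r := mem_sphere.1 hz
    refine hball (hzc ▸ hrε) ?_
    intro hzc'
    rw [hzc', dist_self] at hzc
    exact hrpos.ne hzc
  -- Hurwitz: eventually `J^{d,0}_γ(·/d)` has a zero in the disc
  set g : ℕ → ℂ → ℂ := fun d w ↦ aeval (w / d) (jensenPoly γ d 0) with hg
  have hgd : ∀ᶠ d in atTop, DiffContOnCl ℂ (g d) (ball c r) := Eventually.of_forall fun d ↦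
    (((Polynomial.differentiable_aeval (jensenPoly γ d 0)).comp
      (differentiable_id.div_const (d : ℂ))).diffContOnCl)
  have hunif : TendstoUniformlyOn g φ atTop (closedBall c r) :=
    (tendstoLocallyUniformly_iff_forall_isCompact.1 hconv) _ (isCompact_closedBall c r)
  have hzeros := Complex.eventually_exists_zero_mem_ball_of_tendstoUniformlyOn hrpos hgd hunif
    hφd.continuous.continuousOn hc hsphere
  -- a nonzero Taylor coefficient makes `J^{d,0}_γ ≠ 0` for large `d`
  obtain ⟨k, hk⟩ := exists_re_iteratedDeriv_ne_zero hφd hreal h0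
  obtain ⟨d₀, hd₀⟩ := eventually_atTop.1 (hzeros.and ((eventually_ge_atTop k).and (eventually_gt_atTop 0)))
  refine ⟨d₀, fun d hd hsplit ↦ ?_⟩
  obtain ⟨⟨z, hz, hgz⟩, hdk, hd0⟩ := hd₀ d hd
  -- `z` is non-real, hence so is `z/d`
  have hzim : z.im ≠ 0 := by
    intro him
    have h1 : |z.im - c.im| ≤ ‖z - c‖ := by simpa using Complex.abs_im_le_norm (z - c)
    have h2 : ‖z - c‖ < r := by rwa [← dist_eq_norm, ← mem_ball]
    rw [him, zero_sub, abs_neg] at h1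
    linarith
  have hJ0 : jensenPoly γ d 0 ≠ 0 := by
    intro hJ
    have := congrArg (fun q : ℝ[X] ↦ q.coeff k) hJ
    simp only [coeff_jensenPoly, hdk, if_true, zero_add, coeff_zero, mul_eq_zero,
      Nat.cast_eq_zero] at this
    rcases this with h1 | h1
    · exact (Nat.choose_pos hdk).ne' h1
    · exact hk h1
  have hd0' : (d : ℂ) ≠ 0 := by exact_mod_cast hd0.ne'
  have hzd : (z / d).im ≠ 0 := by
    rw [Complex.div_natCast_im]
    exact div_ne_zero hzim (by exact_mod_cast hd0.ne')
  have hne := eval_map_ne_zero_of_splits hsplit hJ0 hzd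
  rw [Polynomial.eval_map_algebraMap] at hne
  exact hne hgz

/-- **Row-`n` Hurwitz onset**: if `φ^{(n)} ≢ 0` has a non-real zero, then `J^{d,n}_γ` is
non-hyperbolic for all large `d`. [cite: CravenCsordas1989, Lemma 2.2, eq. (2.3)]
[cite: Conway1978, Ch. VII Thm. 2.5] -/
theorem eventually_not_splits_jensenPoly_row (hφd : Differentiable ℂ φ) (hreal : IsRealOnReal φ)
    (n : ℕ) (h0 : ∃ w, iteratedDeriv n φ w ≠ 0) {c : ℂ} (hc : iteratedDeriv n φ c = 0)
    (hci : c.im ≠ 0) :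
    ∃ d₀ : ℕ, ∀ d : ℕ, d₀ ≤ d → ¬ (jensenPoly (fun k ↦ (iteratedDeriv k φ 0).re) d n).Splits := by
  have hd : Differentiable ℂ (iteratedDeriv n φ) := differentiable_iteratedDeriv_of_entire hφd n
  have hr : IsRealOnReal (iteratedDeriv n φ) := fun x ↦ im_iteratedDeriv_ofReal hφd hreal n x
  obtain ⟨d₀, hd₀⟩ := eventually_not_splits_jensenPoly_of_nonreal_zero hd hr h0 hc hci
  refine ⟨d₀, fun d hdd ↦ ?_⟩
  have hkey : jensenPoly (fun k ↦ (iteratedDeriv k (iteratedDeriv n φ) 0).re) d 0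
      = jensenPoly (fun k ↦ (iteratedDeriv k φ 0).re) d n := by
    rw [jensenPoly_shift' _ d n]
    congr 1
    funext k
    rw [iteratedDeriv_iteratedDeriv']
  rw [← hkey]
  exact hd₀ d hdd

/-- **The row dichotomy** (real entire functions of order `< 2`): for each `n` with `F^{(n)} ≢ 0`,
EITHER every `J^{d,n}` is hyperbolic (iff `F^{(n)} ∈ 𝓛𝓟`, iff `F^{(n)}` has only real zeros) OR
`J^{d,n}` is non-hyperbolic for all large `d` — rows are hyperbolic throughout or eventually never.
[cite: CravenCsordas1989, §1 (i), Lemma 2.2] [cite: KiKim2000, §2 p. 49] -/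
theorem splits_jensenPoly_row_dichotomy {F : ℂ → ℂ} (hF : IsEntireOfOrderLt 2 F)
    (hreal : IsRealOnReal F) (n : ℕ) (hnz : ∃ w, iteratedDeriv n F w ≠ 0) :
    (∀ d : ℕ, (jensenPoly (fun k ↦ (iteratedDeriv k F 0).re) d n).Splits) ∨
      ∃ d₀ : ℕ, ∀ d : ℕ, d₀ ≤ d → ¬ (jensenPoly (fun k ↦ (iteratedDeriv k F 0).re) d n).Splits := by
  by_cases hzero : ∀ z, iteratedDeriv n F z = 0 → z.im = 0
  · left
    obtain ⟨hFd, ρ₀, C₀, hρ₀, hgr₀⟩ := hF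
    obtain ⟨ρ, C, hρ0, hρ, -, hgr⟩ := DeBruijn1950.growth_normalise_two hFd hρ₀ hgr₀
    exact (isLaguerrePolya_iteratedDeriv_iff hFd hreal n).1
      (isLaguerrePolya_iteratedDeriv_of_zeros_real hFd hρ0 hρ hgr hreal n hzero)
  · right
    push Not at hzero
    obtain ⟨c, hc, hci⟩ := hzero
    exact eventually_not_splits_jensenPoly_row hF.1 hreal n hnz hc hci

end Jensen

end Literature.Analysis.Complex

end
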